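import Literature.NumberTheory.EllipticCurves.BSDWave0TunnellProofs
import Literature.NumberTheory.EllipticCurves.CongruentNumberCurveLSeriesProofs
import Literature.NumberTheory.EllipticCurves.BSDAnalyticRankTunnellCMProofs
import Literature.NumberTheory.EllipticCurves.ComplexMultiplicationCoatesWilesProofs
import Literature.NumberTheory.EllipticCurves.TunnellHalfIntegralForms
import HarnessLib

/-!
# Tunnell's theorem (bsd.S29, unconditional direction) behind two named facts:
# Coates–Wiles for `j = 1728` from the `𝔭`-divisibility fact alone, fed into the Tunnell chain

Third proof file for `Literature.NumberTheory.EllipticCurves.tunnell_odd` / `Literature.NumberTheory.EllipticCurves.tunnell_even`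
(`Literature.NumberTheory.EllipticCurves.BSDWave0`: Tunnell, Invent. Math. 72 (1983) 323–334,
Theorem of the Introduction (a), (b), p. 323, squarefree case: an odd squarefree congruent `n`
has `#{x² + 2y² + 8z² = n} = 2 · #{x² + 2y² + 32z² = n}`, an even one
`#{8x² + 2y² + 16z² = n} = 2 · #{8x² + 2y² + 64z² = n}`), after
`BSDWave0TunnellProofs` (the printed assembly of §3, p. 329: Coates–Wiles + Theorem 3, resp.
Waldspurger's proportionality, with Coates–Wiles' Theorem 1 for all nine class-number-one `j` as
a hypothesis) and the siblings' discharge of the continuation of `L(E_n, s)`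
(`Literature.NumberTheory.EllipticCurves.hasEntireLFunction_congruentNumberCurve_holds`, `CongruentNumberCurveLSeriesProofs`).

Tunnell's use of Coates–Wiles (p. 325: "the result of Coates–Wiles [7] shows that if
`L(E^D, 1) ≠ 0`, then `E^D(ℚ)` is finite"; §3 p. 329, Theorem (Coates–Wiles)) concerns ONLY the
curves `E^D : y² = x³ - D² x`, which have `j = 1728` and complex multiplication by `ℤ[i]`, the
ring of integers of `K = ℚ(i)` (p. 325) — the curves of Coates–Wiles' own introduction (Invent.
Math. 39 (1977), p. 223: "In particular, the theorem applies to the curves `y² = x³ - Dx`"). For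
`j = 1728` the tree now proves Theorem 1 (`F = ℚ`) from ONE named fact,
`Literature.NumberTheory.EllipticCurves.CoatesWiles1977_L_one_div_period_mem_prime` (the `𝔭`-divisibility of `Ω⁻¹ L(E/ℚ, 1)`
forced by a rational point of infinite order at each good split non-anomalous prime `p > 7`;
Coates–Wiles §6 p. 250: Thm. 29, Cor. 32, Thm. 34, Lemma 35 — elliptic units and the explicit
reciprocity law, a theory): `Literature.NumberTheory.EllipticCurves.entireLFunction_one_eq_zero_of_j_eq_1728_of_mem_prime`
(`ComplexMultiplicationCoatesWilesProofs`: the non-anomalous split primes elementarily, the CM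
period of a `j = 1728` curve by `exists_isCMPeriod_of_j_eq_1728`, the assembly of pp. 250–251 as
printed). This file feeds that theorem into the Tunnell chain (all PROVED, nothing restated):

* `BSD.finite_point_of_j_eq_1728_of_entireLFunction_one_ne_zero` — `L(E, 1) ≠ 0 ⇒ E(ℚ)` finite
  for `j(E) = 1728`, from the `𝔭`-divisibility fact alone: Theorem 1 read with the Mordell–Weil
  theorem (proved in the tree, `WeierstrassCurve.module_finite_point_holds`) as in Coates–Wiles'
  Introduction (p. 223); the `j = 1728` row of the fact
  `BSD.finite_point_of_j_mem_maximalCMJInvariants_of_L_one_ne_zero` (bsd.S28) and exactly the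
  statement Tunnell quotes on p. 325;
* `entireLFunction_one_eq_zero_of_isCongruentNumber_of_mem_prime` — a congruent `n` has
  `L(E_n, 1) = 0` (Tunnell p. 324: `E^D(ℚ)` is infinite iff `D` is congruent — the tree's
  `Literature.NumberTheory.EllipticCurves.Wiles2000.infinite_point_iff_isCongruentNumber_holds` — and p. 325);
* the assemblies `BSD.tunnell_odd_of_mem_prime_lvalue` / `_waldspurger` / `_L_one`, their `even`
  twins, and Theorem (a), (b) in the squarefree case
  (`Tunnell1983.a_eq_zero_of_isCongruentNumber_of_mem_prime_waldspurger`, `b_…`).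

So `Literature.BSD.tunnell_odd_holds` / `tunnell_even_holds` now stand behind exactly **two** named
facts, each a theory absent from Mathlib: Coates–Wiles' `𝔭`-divisibility
(`CoatesWiles1977_L_one_div_period_mem_prime`, needed only at curves with `j = 1728`) and
Waldspurger's theorem as applied by Tunnell on p. 329 — in the form of the proportionality
`Tunnell1983_a_sq_eq_const_mul_L_one`, resp. `_b_` (`BSD.tunnell_odd_of_mem_prime_waldspurger`),
or, one level further down, of Waldspurger's theorem [25, Thm 1] for the newform `φ` of level
`32` itself, `Tunnell1983.Tunnell1983_waldspurger_triv`, resp. `_chi2`, from which the sibling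
`TunnellHalfIntegralForms` PROVES the proportionality by Tunnell's comparison of bases on p. 329
(`BSD.tunnell_odd_of_mem_prime_waldspurger_triv`, `BSD.tunnell_even_of_mem_prime_waldspurger_chi2`).

## References

* J. B. Tunnell, *A classical Diophantine problem and modular forms of weight 3/2*, Invent. Math.
  72 (1983) 323–334: Theorem (a), (b) p. 323; p. 324 (`E^D(ℚ)` infinite iff `D` congruent);
  p. 325 (Coates–Wiles for `E^D`, CM by `ℤ[i]`); §3 p. 329. [Tunnell1983Congruent]
* J. Coates, A. Wiles, *On the conjecture of Birch and Swinnerton-Dyer*, Invent. Math. 39 (1977)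
  223–251: Thm. 1 and the Introduction (p. 223), §6 pp. 250–251. [CoatesWiles1977]
* J. H. Silverman, *The Arithmetic of Elliptic Curves*, 2nd ed., GTM 106 (2009), Thm. VIII.6.7
  (Mordell–Weil). [SilvermanAEC2009]
-/

noncomputable section

open scoped Classical ComplexConjugate

open WeierstrassCurve Complex

namespace Literature.NumberTheory.EllipticCurves

/-! ### Coates–Wiles for `j = 1728`, Mordell–Weil form, from the `𝔭`-divisibility fact alone -/

/-- **`L(E, 1) ≠ 0 ⇒ E(ℚ)` finite for `j(E) = 1728`, from the `𝔭`-divisibility fact alone** —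
the `j = 1728` row of the fact `BSD.finite_point_of_j_mem_maximalCMJInvariants_of_L_one_ne_zero`
(bsd.S28, Mordell–Weil part), read off Theorem 1 with the Mordell–Weil theorem as in
Coates–Wiles' Introduction (p. 223): `E(ℚ)` is finitely generated
(`WeierstrassCurve.module_finite_point_holds`, proved in the tree) and, by Theorem 1 for
`j = 1728` from the `𝔭`-divisibility fact alone (the sibling's
`BSD.entireLFunction_one_eq_zero_of_j_eq_1728_of_mem_prime`, `ComplexMultiplicationCoatesWilesProofs`),
torsion (Mathlib `AddCommGroup.finite_of_fg_torsion`). This is the statement Tunnell quotes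
(p. 325: "if `L(E^D, 1) ≠ 0`, then `E^D(ℚ)` is finite").
[cite: CoatesWiles1977, Thm 1 (p. 223)] [cite: SilvermanAEC2009, Thm. VIII.6.7]
[cite: Tunnell1983Congruent, §1 p. 325] -/
theorem finite_point_of_j_eq_1728_of_entireLFunction_one_ne_zero
    (h1 : EllipticCurves.CoatesWiles1977_L_one_div_period_mem_prime)
    (W : WeierstrassCurve ℚ) [W.IsElliptic] (hj : W.j = 1728) (hL : W.entireLFunction 1 ≠ 0) :
    Finite W.toAffine.Point := by
  have hMW : ∀ (V : WeierstrassCurve ℚ) [V.IsElliptic], V.module_finite_point :=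
    fun V _ => V.module_finite_point_holds
  -- `module_finite_point` is stated under `open scoped Classical`; `convert` bridges the
  -- (subsingleton) `DecidableEq` instances, as in `ComplexMultiplication.lean`.
  haveI : Module.Finite ℤ W.toAffine.Point := by convert hMW W
  haveI : AddGroup.FG W.toAffine.Point := Module.Finite.iff_addGroup_fg.mp inferInstance
  refine AddCommGroup.finite_of_fg_torsion W.toAffine.Point (fun P => ?_)
  by_contra hP
  exact hL (EllipticCurves.entireLFunction_one_eq_zero_of_j_eq_1728_of_mem_prime h1 W hj P hP)

/-! ### Congruent numbers: `L(E_n, 1) = 0` -/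

/-- **If `n` is a congruent number then `L(E_n, 1) = 0`, from the `𝔭`-divisibility fact alone**
(Tunnell 1983, p. 324: "`D` is the area of a rational right triangle if and only if the group
`E^D(ℚ)` … is infinite" — `Wiles2000.infinite_point_iff_isCongruentNumber_holds`, proved in the
tree; p. 325: "the result of Coates–Wiles [7] shows that if `L(E^d, 1) ≠ 0`, then `E^d(ℚ)` is
finite" — `BSD.finite_point_of_j_eq_1728_of_entireLFunction_one_ne_zero` with `j(E_n) = 1728`).
Compare `entireLFunction_one_eq_zero_of_isCongruentNumber` (`BSDWave0TunnellProofs`), which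
takes Coates–Wiles' Theorem 1 for all nine `j` as its hypothesis.
[cite: Tunnell1983Congruent, §1 pp. 324–325] [cite: CoatesWiles1977, Thm 1] -/
theorem entireLFunction_one_eq_zero_of_isCongruentNumber_of_mem_prime
    (h1 : EllipticCurves.CoatesWiles1977_L_one_div_period_mem_prime) {n : ℕ}
    (h : EllipticCurves.IsCongruentNumber n) : (congruentNumberCurve n).entireLFunction 1 = 0 := by
  have hn : 0 < n := h.pos
  haveI := isElliptic_congruentNumberCurve hn.ne'
  haveI : Infinite (congruentNumberCurve n).toAffine.Point :=
    (Wiles2000.infinite_point_iff_isCongruentNumber_holds hn).2 h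
  by_contra hL
  haveI : Finite (congruentNumberCurve n).toAffine.Point :=
    EllipticCurves.finite_point_of_j_eq_1728_of_entireLFunction_one_ne_zero h1 (congruentNumberCurve n)
      (congruentNumberCurve_j n) hL
  exact not_finite (congruentNumberCurve n).toAffine.Point

/-! ### Assembly: bsd.S29 behind two named facts -/

/-- **`Literature.NumberTheory.EllipticCurves.tunnell_odd` from Coates–Wiles' `𝔭`-divisibility and Tunnell's theorem in
vanishing form** (`hT : tunnell_lvalue_odd`, `L(E_n, 1) = 0 ↔` the count identity, for `n`
squarefree odd; the continuation guard is discharged by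
`hasEntireLFunction_congruentNumberCurve_holds`). [cite: Tunnell1983Congruent, §3 (p. 329)] -/
theorem tunnell_odd_of_mem_prime_lvalue (h1 : EllipticCurves.CoatesWiles1977_L_one_div_period_mem_prime)
    (hT : tunnell_lvalue_odd) : EllipticCurves.tunnell_odd := by
  intro n hn hodd h
  exact (hT hn hodd (hasEntireLFunction_congruentNumberCurve_holds hn)).1
    (entireLFunction_one_eq_zero_of_isCongruentNumber_of_mem_prime h1 h)

/-- **`Literature.NumberTheory.EllipticCurves.tunnell_even` from Coates–Wiles' `𝔭`-divisibility and Tunnell's theorem in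
vanishing form** (`hT : tunnell_lvalue_even`). [cite: Tunnell1983Congruent, §3 (p. 329)] -/
theorem tunnell_even_of_mem_prime_lvalue (h1 : EllipticCurves.CoatesWiles1977_L_one_div_period_mem_prime)
    (hT : tunnell_lvalue_even) : EllipticCurves.tunnell_even := by
  intro n hn heven h
  exact (hT hn heven (hasEntireLFunction_congruentNumberCurve_holds hn)).1
    (entireLFunction_one_eq_zero_of_isCongruentNumber_of_mem_prime h1 h)

/-- **`Literature.NumberTheory.EllipticCurves.tunnell_odd` behind exactly two named facts**: Coates–Wiles' `𝔭`-divisibility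
(`CoatesWiles1977_L_one_div_period_mem_prime`, Invent. Math. 39, §6 p. 250) and Waldspurger's
proportionality for `g θ₂` (`Tunnell1983_a_sq_eq_const_mul_L_one`, Tunnell p. 329) — through the
sibling's `tunnell_lvalue_odd_of_waldspurger` and the proved continuation.
[cite: Tunnell1983Congruent, Theorem (a) (p. 323), Theorem (Waldspurger) (p. 328), §3 (p. 329)] -/
theorem tunnell_odd_of_mem_prime_waldspurger
    (h1 : EllipticCurves.CoatesWiles1977_L_one_div_period_mem_prime)
    (hW : Tunnell1983_a_sq_eq_const_mul_L_one) : EllipticCurves.tunnell_odd :=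
  EllipticCurves.tunnell_odd_of_mem_prime_lvalue h1
    (tunnell_lvalue_odd_of_waldspurger hW hasEntireLFunction_congruentNumberCurve_holds)

/-- **`Literature.NumberTheory.EllipticCurves.tunnell_even` behind exactly two named facts**: Coates–Wiles' `𝔭`-divisibility
and Waldspurger's proportionality for `g θ₄` (`Tunnell1983_b_sq_eq_const_mul_L_one`).
[cite: Tunnell1983Congruent, Theorem (b) (p. 323), Theorem (Waldspurger) (p. 328), §3 (p. 329)] -/
theorem tunnell_even_of_mem_prime_waldspurger
    (h1 : EllipticCurves.CoatesWiles1977_L_one_div_period_mem_prime)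
    (hW : Tunnell1983_b_sq_eq_const_mul_L_one) : EllipticCurves.tunnell_even :=
  EllipticCurves.tunnell_even_of_mem_prime_lvalue h1
    (tunnell_lvalue_even_of_waldspurger hW hasEntireLFunction_congruentNumberCurve_holds)

/-- **`Literature.NumberTheory.EllipticCurves.tunnell_odd` from Coates–Wiles' `𝔭`-divisibility and Tunnell's Theorem 3 (odd
twists) as printed** (`Tunnell1983_L_one_odd`: `L(E_d, 1) = a(d)² β d^{-1/2}/4`; §3, p. 329:
"From this and Theorem 3 we obtain immediately our main result").
[cite: Tunnell1983Congruent, Thm 3 (pp. 328–329) and §3 (p. 329)] -/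
theorem tunnell_odd_of_mem_prime_L_one (h1 : EllipticCurves.CoatesWiles1977_L_one_div_period_mem_prime)
    (hT : Tunnell1983_L_one_odd) : EllipticCurves.tunnell_odd :=
  EllipticCurves.tunnell_odd_of_mem_prime_lvalue h1 (tunnell_lvalue_odd_of_L_one_odd hT)

/-- **`Literature.NumberTheory.EllipticCurves.tunnell_even` from Coates–Wiles' `𝔭`-divisibility and Tunnell's Theorem 3 (even
twists) as printed** (`Tunnell1983_L_one_even`).
[cite: Tunnell1983Congruent, Thm 3 (pp. 328–329) and §3 (p. 329)] -/
theorem tunnell_even_of_mem_prime_L_one (h1 : EllipticCurves.CoatesWiles1977_L_one_div_period_mem_prime)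
    (hT : Tunnell1983_L_one_even) : EllipticCurves.tunnell_even :=
  EllipticCurves.tunnell_even_of_mem_prime_lvalue h1 (tunnell_lvalue_even_of_L_one_even hT)

/-- **Tunnell 1983, Theorem (a) (p. 323), squarefree case, behind two named facts**: for `n`
squarefree, odd and congruent, `a(n) = #{2x² + y² + 32z² = n} - ½ #{2x² + y² + 8z² = n} = 0`
(Coates–Wiles' `𝔭`-divisibility and Waldspurger's proportionality for `g θ₂`).
[cite: Tunnell1983Congruent, Theorem (a) (p. 323) and §3 (p. 329)] -/
theorem Tunnell1983.a_eq_zero_of_isCongruentNumber_of_mem_prime_waldspurger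
    (h1 : EllipticCurves.CoatesWiles1977_L_one_div_period_mem_prime)
    (hW : Tunnell1983_a_sq_eq_const_mul_L_one) {n : ℕ} (hn : Squarefree n) (hodd : Odd n)
    (h : EllipticCurves.IsCongruentNumber n) : Tunnell1983.a n = 0 :=
  (Tunnell1983.a_eq_zero_iff n).2 (EllipticCurves.tunnell_odd_of_mem_prime_waldspurger h1 hW hn hodd h)

/-- **Tunnell 1983, Theorem (b) (p. 323), squarefree case, behind two named facts**: for `2d`
squarefree and congruent, `b(d) = #{4x² + y² + 32z² = d} - ½ #{4x² + y² + 8z² = d} = 0`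
(Coates–Wiles' `𝔭`-divisibility and Waldspurger's proportionality for `g θ₄`).
[cite: Tunnell1983Congruent, Theorem (b) (p. 323) and §3 (p. 329)] -/
theorem Tunnell1983.b_eq_zero_of_isCongruentNumber_of_mem_prime_waldspurger
    (h1 : EllipticCurves.CoatesWiles1977_L_one_div_period_mem_prime)
    (hW : Tunnell1983_b_sq_eq_const_mul_L_one) {d : ℕ} (hd : Squarefree (2 * d))
    (h : EllipticCurves.IsCongruentNumber (2 * d)) : Tunnell1983.b d = 0 :=
  (Tunnell1983.b_eq_zero_iff d).2
    (EllipticCurves.tunnell_even_of_mem_prime_waldspurger h1 hW hd (even_two_mul d) h)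

/-! ### Down to Waldspurger's theorem for `φ` itself (Tunnell 1983, Theorem (Waldspurger), p. 328) -/

/-- **`Literature.NumberTheory.EllipticCurves.tunnell_odd` behind the two deepest named facts currently in the tree**:
Coates–Wiles' `𝔭`-divisibility (`CoatesWiles1977_L_one_div_period_mem_prime`, Invent. Math. 39,
§6 p. 250) and Waldspurger's theorem for `φ`, trivial character, as applied on p. 329
(`Tunnell1983.Tunnell1983_waldspurger_triv`: `A(t)² = L(Eᵗ, 1)` and the four forms
`∑ A(n^{sf}) c(n) qⁿ` span the space of `g θ₂, g θ₈`), through the sibling's PROVED comparison of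
bases `Tunnell1983.Tunnell1983_a_sq_eq_const_mul_L_one_of_facts` (p. 329) and
`BSD.tunnell_odd_of_mem_prime_waldspurger`.
[cite: Tunnell1983Congruent, Theorem (a) (p. 323), Theorem (Waldspurger) (p. 328), §3 (p. 329)] -/
theorem tunnell_odd_of_mem_prime_waldspurger_triv
    (h1 : EllipticCurves.CoatesWiles1977_L_one_div_period_mem_prime)
    (hW : Tunnell1983.Tunnell1983_waldspurger_triv) : EllipticCurves.tunnell_odd :=
  EllipticCurves.tunnell_odd_of_mem_prime_waldspurger h1
    (Tunnell1983.Tunnell1983_a_sq_eq_const_mul_L_one_of_facts hW)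

/-- **`Literature.NumberTheory.EllipticCurves.tunnell_even` behind the two deepest named facts currently in the tree**:
Coates–Wiles' `𝔭`-divisibility and Waldspurger's theorem for `φ`, character `χ₂`, as applied on
p. 329 (`Tunnell1983.Tunnell1983_waldspurger_chi2`: `A(t)² = L(E²ᵗ, 1)` and the four Waldspurger
forms span the space of `g θ₄, g θ₁₆`), through
`Tunnell1983.Tunnell1983_b_sq_eq_const_mul_L_one_of_facts` and
`BSD.tunnell_even_of_mem_prime_waldspurger`.
[cite: Tunnell1983Congruent, Theorem (b) (p. 323), Theorem (Waldspurger) (p. 328), §3 (p. 329)] -/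
theorem tunnell_even_of_mem_prime_waldspurger_chi2
    (h1 : EllipticCurves.CoatesWiles1977_L_one_div_period_mem_prime)
    (hW : Tunnell1983.Tunnell1983_waldspurger_chi2) : EllipticCurves.tunnell_even :=
  EllipticCurves.tunnell_even_of_mem_prime_waldspurger h1
    (Tunnell1983.Tunnell1983_b_sq_eq_const_mul_L_one_of_facts hW)

end Literature.NumberTheory.EllipticCurves
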